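import Literature.Analysis.FluidPDE.DeRosaIsettIncrementEstimates
import Literature.Analysis.FluidPDE.DeRosaIsettTestSupport
import Literature.Analysis.FluidPDE.EnergyFluxMollifiedTest
import Literature.Analysis.FunctionSpaces.BesovLowerSemicontinuity
import HarnessLib

/-!
# Space–time `L^{q/3}` bounds for the terms of De Rosa–Isett's §5.1 and the thin-set pairing lemma

Analysis/FluidPDE support file (theorem-only; serves the discharge of
`Literature.Barriers.AnomalousDissipation.DeRosaIsett2024_s51_finalBound`). The symmetric
Duchon–Robert identity `Torus.two_mul_energyFlux_add_energyFlux_mollified_eq` expresses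
`2(𝓔(ψ) + 𝓔(ψ ⋆ₓ k_ε))` as `∫∫𝒟_K ψ + ∫∫ω_K(∂ₜψ + ⟪v,∇ψ⟫) + 2∫∫⟪𝒞_K,∇ψ⟫`; De Rosa–Isett
(ARMA 248 (2024), §5.1) bound each pairing by Hölder in `L^{p/3}_{x,t} × L^{(p/3)'}_{x,t}` with the
cut-off test `φχ_δ` ((est_D_first_easy), (est_II), (eul_Rey_err), (est_III)). This file provides:

* `abs_integral_le_mul_toReal_setLIntegral` — `|∫ f| ≤ b · ∫_A ‖F‖` when `‖f‖ ≤ ‖F‖ g` with a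
  weight `g ≤ b` vanishing off `A` (the cut-off bookkeeping);
* `eLpNorm_uncurry_eq_rpow_lintegral_eLpNorm_slice` — `‖F‖_{L^r(dt dx)} = (∫₀ᵀ ‖F(t)‖^r_{L^r})^{1/r}`;
* the space–time `L^{q/3}((0,T) × T^d)` bounds of the three slice quantities for
  `v ∈ L^q(0,T; B^θ_{q,∞})`, `q ∈ [3,∞)`, `N = ‖v‖_{L^q_t B^θ_{q,∞}}`:
  `‖𝒟_{k_ε}(v)‖ ≤ (C₁/ε) ε^{3θ} N³` (`eLpNorm_uncurry_kernelFlux_le`),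
  `‖ω_K(v)‖ ≤ ε^{2θ} (N^q + T)^{3/q}`, `‖ω_K(v) |v|‖ ≤ ε^{2θ} N³`
  (`eLpNorm_uncurry_quadIncrement_le`, `eLpNorm_uncurry_quadIncrement_mul_norm_le`), and
  `‖𝒞_K(p,v)‖ ≤ C_q ε^{2θ} N³` given the slice-wise pressure bound
  `[p(t)]_{B^θ_{q/2}} ≤ C_q‖v(t)‖_q[v(t)]_{B^θ_q}` of `PressureBesovRegularity`
  (`eLpNorm_uncurry_pressureRemainder_le`).

## References

* L. De Rosa, P. Isett, Arch. Ration. Mech. Anal. 248 (2024), Paper No. 11, §5.1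
  ((est_D_first_easy), (est_II), (eul_Rey_err), (est_III)). [DeRosaIsett2024]
-/

noncomputable section

open MeasureTheory TopologicalSpace Set Function Filter Metric
open _root_.Topology
open scoped ENNReal NNReal Convolution InnerProductSpace RealInnerProductSpace

namespace Literature.Analysis.FluidPDE.Torus

open Literature.Analysis.FunctionSpaces

/-! ## The thin-set pairing lemma -/

section Pairing

variable {X : Type*} [MeasurableSpace X] {μ : Measure X} {E : Type*} [NormedAddCommGroup E]

/-- **Pairings against cut-off weights.** If `‖f‖ ≤ ‖F‖ · g` pointwise with a weight `g` bounded
by `b` on a measurable set `A` and vanishing off `A`, `F` measurable with `∫_A ‖F‖ < ∞`, then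
`|∫ f| ≤ b ∫_A ‖F‖` (the book-keeping behind `|⟨G, φχ_δ⟩| ≤ ‖φχ_δ‖_∞ ∫_{spt χ_δ}|G|`). [folklore] -/
theorem abs_integral_le_mul_toReal_setLIntegral {f : X → ℝ} {F : X → E} {g : X → ℝ}
    (hF : AEStronglyMeasurable F μ) {A : Set X} (hA : MeasurableSet A) {b : ℝ}
    (hfg : ∀ z, ‖f z‖ ≤ ‖F z‖ * g z) (hgb : ∀ z ∈ A, g z ≤ b)
    (hgA : ∀ z, z ∉ A → g z = 0) (hfin : ∫⁻ z in A, ‖F z‖ₑ ∂μ < ⊤) :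
    |∫ z, f z ∂μ| ≤ b * (∫⁻ z in A, ‖F z‖ₑ ∂μ).toReal := by
  have hFi : IntegrableOn (fun z => ‖F z‖) A μ :=
    ⟨hF.norm.restrict, by simpa [HasFiniteIntegral, enorm_norm] using hfin⟩
  set bound : X → ℝ := fun z => b * A.indicator (fun z => ‖F z‖) z with hbound
  have hbi : Integrable bound μ := (hFi.integrable_indicator hA).const_mul b
  have hle : ∀ z, ‖f z‖ ≤ bound z := by
    intro z
    by_cases hz : z ∈ A
    · show ‖f z‖ ≤ b * A.indicator (fun z => ‖F z‖) z
      rw [indicator_of_mem hz]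
      calc ‖f z‖ ≤ ‖F z‖ * g z := hfg z
        _ ≤ ‖F z‖ * b := mul_le_mul_of_nonneg_left (hgb z hz) (norm_nonneg _)
        _ = b * ‖F z‖ := mul_comm _ _
    · show ‖f z‖ ≤ b * A.indicator (fun z => ‖F z‖) z
      rw [indicator_of_notMem hz, mul_zero]
      calc ‖f z‖ ≤ ‖F z‖ * g z := hfg z
        _ = 0 := by rw [hgA z hz, mul_zero]
  calc |∫ z, f z ∂μ| = ‖∫ z, f z ∂μ‖ := (Real.norm_eq_abs _).symm
    _ ≤ ∫ z, bound z ∂μ := norm_integral_le_of_norm_le hbi (ae_of_all _ hle)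
    _ = b * (∫⁻ z in A, ‖F z‖ₑ ∂μ).toReal := by
        rw [hbound, integral_const_mul, integral_indicator hA, integral_norm_eq_lintegral_enorm hF.restrict]

end Pairing

/-! ## Space–time `L^r` norms from slice norms -/

section SpaceTime

variable {d : Type*} [Fintype d] {E : Type*} [NormedAddCommGroup E]

/-- `‖F‖_{L^r(dt dx)} = (∫₀ᵀ ‖F(t)‖^r_{L^r(T^d)} dt)^{1/r}` for jointly measurable `F`, `0 < r < ∞`
(Tonelli). [folklore] -/
theorem eLpNorm_uncurry_eq_rpow_lintegral_eLpNorm_slice {T : ℝ} {F : ℝ → UnitAddTorus d → E}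
    (hF : AEStronglyMeasurable (uncurry F) ((volume.restrict (Ioo 0 T)).prod volume))
    {r : ℝ≥0∞} (hr0 : r ≠ 0) (hrt : r ≠ ⊤) :
    eLpNorm (uncurry F) r ((volume.restrict (Ioo 0 T)).prod volume) =
      (∫⁻ t in Ioo 0 T, eLpNorm (F t) r volume ^ r.toReal) ^ (1 / r.toReal) := by
  rw [eLpNorm_eq_lintegral_rpow_enorm_toReal hr0 hrt, lintegral_prod _ (hF.enorm.pow_const _)]
  congr 1
  refine lintegral_congr fun t => ?_
  rw [eLpNorm_eq_lintegral_rpow_enorm_toReal hr0 hrt, one_div,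
    ENNReal.rpow_inv_rpow (ENNReal.toReal_pos hr0 hrt).ne']
  rfl

/-- **Space–time `L^r` bound from slice bounds**: if `‖F(t)‖_{L^r} ≤ c · h(t)` for a.e.
`t ∈ (0,T)` with a finite constant `c`, then `‖F‖_{L^r(dt dx)} ≤ c (∫₀ᵀ h^r)^{1/r}` (`0 < r < ∞`). [folklore] -/
theorem eLpNorm_uncurry_le_of_slice_le {T : ℝ} {F : ℝ → UnitAddTorus d → E}
    (hF : AEStronglyMeasurable (uncurry F) ((volume.restrict (Ioo 0 T)).prod volume))
    {r : ℝ≥0∞} (hr0 : r ≠ 0) (hrt : r ≠ ⊤) {c : ℝ≥0∞} (hc : c ≠ ⊤) {h : ℝ → ℝ≥0∞}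
    (hle : ∀ᵐ t ∂(volume.restrict (Ioo 0 T)), eLpNorm (F t) r volume ≤ c * h t) :
    eLpNorm (uncurry F) r ((volume.restrict (Ioo 0 T)).prod volume) ≤
      c * (∫⁻ t in Ioo 0 T, h t ^ r.toReal) ^ (1 / r.toReal) := by
  have hrr : 0 < r.toReal := ENNReal.toReal_pos hr0 hrt
  rw [eLpNorm_uncurry_eq_rpow_lintegral_eLpNorm_slice hF hr0 hrt]
  calc (∫⁻ t in Ioo 0 T, eLpNorm (F t) r volume ^ r.toReal) ^ (1 / r.toReal)
      ≤ (∫⁻ t in Ioo 0 T, (c * h t) ^ r.toReal) ^ (1 / r.toReal) := by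
        refine ENNReal.rpow_le_rpow (lintegral_mono_ae (hle.mono fun t ht => ?_)) (by positivity)
        exact ENNReal.rpow_le_rpow ht hrr.le
    _ = (c ^ r.toReal * ∫⁻ t in Ioo 0 T, h t ^ r.toReal) ^ (1 / r.toReal) := by
        congr 1
        rw [← lintegral_const_mul' _ _ (ENNReal.rpow_ne_top_of_nonneg hrr.le hc)]
        refine lintegral_congr fun t => ?_
        rw [ENNReal.mul_rpow_of_nonneg _ _ hrr.le]
    _ = c * (∫⁻ t in Ioo 0 T, h t ^ r.toReal) ^ (1 / r.toReal) := by
        rw [ENNReal.mul_rpow_of_nonneg _ _ (by positivity), ← ENNReal.rpow_mul,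
          mul_one_div_cancel hrr.ne', ENNReal.rpow_one]

end SpaceTime


/-! ## The `L^q_t B^θ_{q,∞}` bookkeeping -/

section Besov

variable {d : Type*} [Fintype d] {T : ℝ} {v : ℝ → UnitAddTorus d → EuclideanSpace ℝ d} {q : ℝ≥0∞} {θ : ℝ}

/-- `N^q = ∫₀ᵀ ‖v(t)‖^q_{B^θ_{q,∞}} dt` for `v ∈ L^q_t B^θ_{q,∞}`, `0 < q < ∞`. [folklore] -/
theorem lintegral_eBesovSupNorm_rpow_eq (hq0 : q ≠ 0) (hq' : q ≠ ⊤)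
    (hv : MemLpBesovSup q θ q v volume (Ioo 0 T)) :
    ∫⁻ t in Ioo 0 T, eBesovSupNorm θ q (v t) volume ^ q.toReal =
      eLpBesovSupNorm q θ q v volume (Ioo 0 T) ^ q.toReal := by
  have hqq : 0 < q.toReal := ENNReal.toReal_pos hq0 hq'
  have hfin : ∀ᵐ t ∂(volume.restrict (Ioo 0 T)), eBesovSupNorm θ q (v t) volume < ⊤ :=
    hv.1.mono fun t ht => ht.eBesovSupNorm_lt_top
  rw [FunctionSpaces.Torus.eLpBesovSupNorm_eq_lintegral hq0 hq' hfin, ← ENNReal.rpow_mul, one_div_mul_cancel hqq.ne',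
    ENNReal.rpow_one]

/-- `∫₀ᵀ ‖v(t)‖^{qα}_{B} ≤ N^q + T` for `0 ≤ α ≤ 1` (`b^{qα} ≤ b^q + 1`). [folklore] -/
theorem lintegral_eBesovSupNorm_rpow_le (hq0 : q ≠ 0) (hq' : q ≠ ⊤)
    (hv : MemLpBesovSup q θ q v volume (Ioo 0 T)) {e : ℝ} (he0 : 0 ≤ e) (he : e ≤ q.toReal) :
    ∫⁻ t in Ioo 0 T, eBesovSupNorm θ q (v t) volume ^ e ≤
      eLpBesovSupNorm q θ q v volume (Ioo 0 T) ^ q.toReal + ENNReal.ofReal T := by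
  have hpt : ∀ b : ℝ≥0∞, b ^ e ≤ b ^ q.toReal + 1 := by
    intro b
    rcases le_total b 1 with hb | hb
    · exact (ENNReal.rpow_le_one hb he0).trans (le_add_self)
    · exact (ENNReal.rpow_le_rpow_of_exponent_le hb he).trans (le_self_add)
  calc ∫⁻ t in Ioo 0 T, eBesovSupNorm θ q (v t) volume ^ e
      ≤ ∫⁻ t in Ioo 0 T, (eBesovSupNorm θ q (v t) volume ^ q.toReal + 1) := lintegral_mono fun t => hpt _
    _ = eLpBesovSupNorm q θ q v volume (Ioo 0 T) ^ q.toReal + ENNReal.ofReal T := by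
        rw [lintegral_add_right _ measurable_const, lintegral_eBesovSupNorm_rpow_eq hq0 hq' hv,
          setLIntegral_const, Real.volume_Ioo, sub_zero, one_mul]

end Besov

/-! ## The four space–time bounds -/

section Terms

variable {d : Type*} [Fintype d] {T ε : ℝ} {v : ℝ → UnitAddTorus d → EuclideanSpace ℝ d}
  {p : ℝ → UnitAddTorus d → ℝ} {q : ℝ≥0∞} {θ : ℝ}

/-- `3 · (q/3) = q` and `2 · (q/2) = q` in `ℝ≥0∞`. [folklore] -/
theorem three_mul_div_three (q : ℝ≥0∞) : 3 * (q / 3) = q :=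
  ENNReal.mul_div_cancel (by norm_num) (by norm_num)

/-- `2 · (q/2) = q` in `ℝ≥0∞`. [folklore] -/
theorem two_mul_div_two (q : ℝ≥0∞) : 2 * (q / 2) = q :=
  ENNReal.mul_div_cancel (by norm_num) (by norm_num)

/-- `(q/3).toReal = q.toReal/3`, and `1 ≤ q/3`, `q/3 ≠ 0, ⊤` for `3 ≤ q < ∞`. [folklore] -/
theorem div_three_facts (hq : 3 ≤ q) (hq' : q ≠ ⊤) :
    1 ≤ q / 3 ∧ q / 3 ≠ 0 ∧ q / 3 ≠ ⊤ ∧ (q / 3).toReal = q.toReal / 3 := by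
  refine ⟨?_, ?_, ENNReal.div_ne_top hq' (by norm_num), by rw [ENNReal.toReal_div]; norm_num⟩
  · rw [ENNReal.le_div_iff_mul_le (Or.inl (by norm_num)) (Or.inl (by norm_num)), one_mul]
    exact hq
  · exact (ENNReal.div_pos_iff.2 ⟨(lt_of_lt_of_le (by norm_num) hq).ne', by norm_num⟩).ne'

/-- `(∫₀ᵀ (b³)^{q/3})^{3/q} = N³`-type exponent algebra: `(x^{q})^{(1/(q/3))} = x^3`-free form:
`(N^{q})^{1/(q/3).toReal} = N^3`. [folklore] -/
theorem rpow_toReal_rpow_inv_div_three (hq : 3 ≤ q) (hq' : q ≠ ⊤) (N : ℝ≥0∞) :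
    (N ^ q.toReal) ^ (1 / (q / 3).toReal) = N ^ (3 : ℕ) := by
  obtain ⟨-, -, -, h3⟩ := div_three_facts hq hq'
  have hqq : 0 < q.toReal := ENNReal.toReal_pos (lt_of_lt_of_le (by norm_num) hq).ne' hq'
  rw [h3, ← ENNReal.rpow_mul, ← ENNReal.rpow_natCast]
  congr 1
  field_simp
  norm_num

/-- `‖v(t)‖_{L^q} ≤ ‖v(t)‖_{B}` and `[v(t)]_{B^θ_q} ≤ ‖v(t)‖_{B}`. [folklore] -/
theorem eLpNorm_le_eBesovSupNorm' (u : UnitAddTorus d → EuclideanSpace ℝ d) (θ : ℝ) (q : ℝ≥0∞) :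
    eLpNorm u q volume ≤ eBesovSupNorm θ q u volume ∧
      eBesovSupSeminorm θ q u volume ≤ eBesovSupNorm θ q u volume :=
  ⟨le_self_add, le_add_self⟩

/-- **The flux term** (De Rosa–Isett 2024, (est_D_first_easy)/(est_flux)): for
`v ∈ L^q_t B^θ_{q,∞}`, `3 ≤ q < ∞`, `0 < ε ≤ 1/4`,
`‖𝒟_{k_ε}(v)‖_{L^{q/3}((0,T) × T^d)} ≤ (C₁/ε) ε^{3θ} N³`, `N = ‖v‖_{L^q_t B^θ_{q,∞}}`. [cite: DeRosaIsett2024, §5.1 (est_D_first_easy)] -/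
theorem eLpNorm_uncurry_kernelFlux_le
    (hvm : AEStronglyMeasurable (uncurry v) ((volume.restrict (Ioo 0 T)).prod volume))
    (hq : 3 ≤ q) (hq' : q ≠ ⊤) (hθ : 0 < θ) (hv : MemLpBesovSup q θ q v volume (Ioo 0 T))
    (hε : 0 < ε) (hε' : ε ≤ 1 / 4) :
    eLpNorm (uncurry fun t x => kernelFlux (FunctionSpaces.Torus.kernel ε) (v t) x) (q / 3)
        ((volume.restrict (Ioo 0 T)).prod volume) ≤
      ENNReal.ofReal (ε⁻¹ * FunctionSpaces.Torus.gradProfileMass d) * ENNReal.ofReal (ε ^ θ) ^ 3 *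
        eLpBesovSupNorm q θ q v volume (Ioo 0 T) ^ (3 : ℕ) := by
  set μT := (volume.restrict (Ioo 0 T)).prod (volume : Measure (UnitAddTorus d)) with hμT
  set K := FunctionSpaces.Torus.kernel (d := d) ε with hKdef
  have hK : FunctionSpaces.Torus.IsSmooth K := FunctionSpaces.Torus.isSmooth_kernel hε hε'
  obtain ⟨hr1, hr0, hrt, hr3⟩ := div_three_facts hq hq'
  have hq0 : q ≠ 0 := (lt_of_lt_of_le (by norm_num) hq).ne'
  -- measurability of the flux field
  have hFm : AEStronglyMeasurable (uncurry fun t x => kernelFlux K (v t) x) μT := by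
    have hδ : AEStronglyMeasurable (fun w : (ℝ × UnitAddTorus d) × UnitAddTorus d =>
        v w.1.1 (w.1.2 + w.2) - v w.1.1 w.1.2) (μT.prod volume) :=
      (aestronglyMeasurable_translate (ν := volume) hvm measurable_id).sub hvm.comp_fst
    have hΨ : AEStronglyMeasurable (fun w : (ℝ × UnitAddTorus d) × UnitAddTorus d =>
        ⟪FunctionSpaces.Torus.gradient K w.2, v w.1.1 (w.1.2 + w.2) - v w.1.1 w.1.2⟫ *
          ‖v w.1.1 (w.1.2 + w.2) - v w.1.1 w.1.2‖ ^ 2) (μT.prod volume) :=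
      ((hK.gradient.continuous.aestronglyMeasurable.comp_snd).inner hδ).mul (hδ.norm.pow 2)
    exact hΨ.integral_prod_right'
  -- slice bound
  set b : ℝ → ℝ≥0∞ := fun t => eBesovSupNorm θ q (v t) volume with hb
  have hslice : ∀ᵐ t ∂(volume.restrict (Ioo 0 T)),
      eLpNorm (fun x => kernelFlux K (v t) x) (q / 3) volume ≤
        (ENNReal.ofReal (ε⁻¹ * FunctionSpaces.Torus.gradProfileMass d) * ENNReal.ofReal (ε ^ θ) ^ 3) *
          b t ^ (3 : ℝ) := by
    filter_upwards [ae_aestronglyMeasurable_slice hvm] with t ht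
    have h1 := eLpNorm_kernelFlux_le (d := d) ht hε hε' hr1 hrt hθ
    rw [three_mul_div_three] at h1
    have h2 : (eBesovSupSeminorm θ q (v t) volume * ENNReal.ofReal (ε ^ θ)) ^ 3 ≤
        ENNReal.ofReal (ε ^ θ) ^ 3 * b t ^ (3 : ℝ) := by
      rw [mul_pow, mul_comm, show (3 : ℝ) = ((3 : ℕ) : ℝ) by norm_num, ENNReal.rpow_natCast]
      gcongr
      exact (eLpNorm_le_eBesovSupNorm' (v t) θ q).2
    calc _ ≤ _ := h1
      _ ≤ ENNReal.ofReal (ε⁻¹ * FunctionSpaces.Torus.gradProfileMass d) *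
          (ENNReal.ofReal (ε ^ θ) ^ 3 * b t ^ (3 : ℝ)) := by gcongr
      _ = _ := by ring
  have hc : ENNReal.ofReal (ε⁻¹ * FunctionSpaces.Torus.gradProfileMass d) * ENNReal.ofReal (ε ^ θ) ^ 3 ≠ ⊤ :=
    ENNReal.mul_ne_top ENNReal.ofReal_ne_top (ENNReal.pow_ne_top ENNReal.ofReal_ne_top)
  refine (eLpNorm_uncurry_le_of_slice_le hFm hr0 hrt hc hslice).trans (le_of_eq ?_)
  congr 1
  have e1 : ∀ t, (b t ^ (3 : ℝ)) ^ (q / 3).toReal = b t ^ q.toReal := fun t => by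
    rw [← ENNReal.rpow_mul, hr3]
    congr 1
    ring
  simp_rw [e1]
  rw [lintegral_eBesovSupNorm_rpow_eq hq0 hq' hv, rpow_toReal_rpow_inv_div_three hq hq']

/-- The quadratic commutator field `ω_K(v)(t,x) = |v|² + (|v|² ⋆ K) - 2⟪v, v ⋆ K⟫` is jointly
measurable. [folklore] -/
theorem aestronglyMeasurable_uncurry_quadIncrement {K : UnitAddTorus d → ℝ} (hKc : Continuous K)
    (hvm : AEStronglyMeasurable (uncurry v) ((volume.restrict (Ioo 0 T)).prod volume)) :
    AEStronglyMeasurable (uncurry fun t x => ‖v t x‖ ^ 2 + ((fun y => ‖v t y‖ ^ 2) ⋆ K) x -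
      2 * ⟪v t x, vecConv (v t) K x⟫) ((volume.restrict (Ioo 0 T)).prod volume) := by
  have h1 : AEStronglyMeasurable (uncurry fun t y => ‖v t y‖ ^ 2) ((volume.restrict (Ioo 0 T)).prod volume) :=
    hvm.norm.pow 2
  have h2 := FunctionSpaces.Torus.aestronglyMeasurable_uncurry_convolution (ContinuousLinearMap.lsmul ℝ ℝ) h1 hKc
  have h3 := aestronglyMeasurable_uncurry_vecConv hvm hKc
  exact (h1.add h2).sub ((hvm.inner h3).const_mul 2)

/-- **The quadratic commutator term** (De Rosa–Isett 2024, (eul_Rey_err) with `R_ε ∼ ω_K`):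
`‖ω_{k_ε}(v)‖_{L^{q/3}((0,T) × T^d)} ≤ ε^{2θ} (N^q + T)^{3/q}`. [cite: DeRosaIsett2024, §5.1 (eul_Rey_err)] -/
theorem eLpNorm_uncurry_quadIncrement_le
    (hvm : AEStronglyMeasurable (uncurry v) ((volume.restrict (Ioo 0 T)).prod volume))
    (hq : 3 ≤ q) (hq' : q ≠ ⊤) (hθ : 0 < θ) (hv : MemLpBesovSup q θ q v volume (Ioo 0 T))
    (hε : 0 < ε) (hε' : ε ≤ 1 / 4) :
    eLpNorm (uncurry fun t x => ‖v t x‖ ^ 2 + ((fun y => ‖v t y‖ ^ 2) ⋆ FunctionSpaces.Torus.kernel ε) x -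
        2 * ⟪v t x, vecConv (v t) (FunctionSpaces.Torus.kernel ε) x⟫) (q / 3)
        ((volume.restrict (Ioo 0 T)).prod volume) ≤
      ENNReal.ofReal (ε ^ θ) ^ 2 *
        (eLpBesovSupNorm q θ q v volume (Ioo 0 T) ^ q.toReal + ENNReal.ofReal T) ^ (1 / (q / 3).toReal) := by
  set K := FunctionSpaces.Torus.kernel (d := d) ε with hKdef
  have hK : FunctionSpaces.Torus.IsSmooth K := FunctionSpaces.Torus.isSmooth_kernel hε hε'
  obtain ⟨hr1, hr0, hrt, hr3⟩ := div_three_facts hq hq'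
  have hq0 : q ≠ 0 := (lt_of_lt_of_le (by norm_num) hq).ne'
  have hq2 : 1 ≤ q / 2 := by
    rw [ENNReal.le_div_iff_mul_le (Or.inl (by norm_num)) (Or.inl (by norm_num)), one_mul]
    exact le_trans (by norm_num) hq
  have hq2t : q / 2 ≠ ⊤ := ENNReal.div_ne_top hq' (by norm_num)
  have h32 : q / 3 ≤ q / 2 := ENNReal.div_le_div_left (by norm_num) q
  have hFm := aestronglyMeasurable_uncurry_quadIncrement (T := T) (v := v) hK.continuous hvm
  set b : ℝ → ℝ≥0∞ := fun t => eBesovSupNorm θ q (v t) volume with hb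
  have hslice : ∀ᵐ t ∂(volume.restrict (Ioo 0 T)),
      eLpNorm (fun x => ‖v t x‖ ^ 2 + ((fun y => ‖v t y‖ ^ 2) ⋆ K) x - 2 * ⟪v t x, vecConv (v t) K x⟫)
        (q / 3) volume ≤ ENNReal.ofReal (ε ^ θ) ^ 2 * b t ^ (2 : ℝ) := by
    filter_upwards [ae_aestronglyMeasurable_slice hFm, hv.1] with t ht hBt
    have h2 : MemLp (v t) 2 volume := hBt.memLp.mono_exponent (le_trans (by norm_num) hq)
    calc eLpNorm (fun x => ‖v t x‖ ^ 2 + ((fun y => ‖v t y‖ ^ 2) ⋆ K) x - 2 * ⟪v t x, vecConv (v t) K x⟫)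
          (q / 3) volume
        ≤ eLpNorm (fun x => ‖v t x‖ ^ 2 + ((fun y => ‖v t y‖ ^ 2) ⋆ K) x - 2 * ⟪v t x, vecConv (v t) K x⟫)
          (q / 2) volume := eLpNorm_le_eLpNorm_of_exponent_le h32 ht
      _ ≤ (eBesovSupSeminorm θ (2 * (q / 2)) (v t) volume * ENNReal.ofReal (ε ^ θ)) ^ 2 :=
          eLpNorm_quadIncrement_le h2 hε hε' hq2 hq2t hθ
      _ ≤ ENNReal.ofReal (ε ^ θ) ^ 2 * b t ^ (2 : ℝ) := by
          rw [two_mul_div_two, mul_pow, mul_comm, show (2 : ℝ) = ((2 : ℕ) : ℝ) by norm_num,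
            ENNReal.rpow_natCast]
          gcongr
          exact (eLpNorm_le_eBesovSupNorm' (v t) θ q).2
  have hc : ENNReal.ofReal (ε ^ θ) ^ 2 ≠ ⊤ := ENNReal.pow_ne_top ENNReal.ofReal_ne_top
  refine (eLpNorm_uncurry_le_of_slice_le hFm hr0 hrt hc hslice).trans ?_
  gcongr
  have e1 : ∀ t, (b t ^ (2 : ℝ)) ^ (q / 3).toReal = b t ^ (2 * q.toReal / 3) := fun t => by
    rw [← ENNReal.rpow_mul, hr3]
    congr 1
    ring
  simp_rw [e1]
  have hqq : 0 < q.toReal := ENNReal.toReal_pos hq0 hq'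
  exact lintegral_eBesovSupNorm_rpow_le hq0 hq' hv (by positivity) (by nlinarith)

/-- **The quadratic commutator against `|v|`** (the transport pairing `∫∫ ω_K ⟪v, ∇ψ⟫`):
`‖ω_{k_ε}(v) |v|‖_{L^{q/3}((0,T) × T^d)} ≤ ε^{2θ} N³` (Hölder `q/2, q`). [cite: DeRosaIsett2024, §5.1 (eul_Rey_err)] -/
theorem eLpNorm_uncurry_quadIncrement_mul_norm_le
    (hvm : AEStronglyMeasurable (uncurry v) ((volume.restrict (Ioo 0 T)).prod volume))
    (hq : 3 ≤ q) (hq' : q ≠ ⊤) (hθ : 0 < θ) (hv : MemLpBesovSup q θ q v volume (Ioo 0 T))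
    (hε : 0 < ε) (hε' : ε ≤ 1 / 4) :
    eLpNorm (uncurry fun t x => (‖v t x‖ ^ 2 + ((fun y => ‖v t y‖ ^ 2) ⋆ FunctionSpaces.Torus.kernel ε) x -
        2 * ⟪v t x, vecConv (v t) (FunctionSpaces.Torus.kernel ε) x⟫) * ‖v t x‖) (q / 3)
        ((volume.restrict (Ioo 0 T)).prod volume) ≤
      ENNReal.ofReal (ε ^ θ) ^ 2 * eLpBesovSupNorm q θ q v volume (Ioo 0 T) ^ (3 : ℕ) := by
  set K := FunctionSpaces.Torus.kernel (d := d) ε with hKdef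
  have hK : FunctionSpaces.Torus.IsSmooth K := FunctionSpaces.Torus.isSmooth_kernel hε hε'
  obtain ⟨hr1, hr0, hrt, hr3⟩ := div_three_facts hq hq'
  have hq0 : q ≠ 0 := (lt_of_lt_of_le (by norm_num) hq).ne'
  have hq2 : 1 ≤ q / 2 := by
    rw [ENNReal.le_div_iff_mul_le (Or.inl (by norm_num)) (Or.inl (by norm_num)), one_mul]
    exact le_trans (by norm_num) hq
  have hq2t : q / 2 ≠ ⊤ := ENNReal.div_ne_top hq' (by norm_num)
  haveI hHT : ENNReal.HolderTriple (q / 2) q (q / 3) := by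
    refine ⟨?_⟩
    rw [ENNReal.inv_div (Or.inr hq') (Or.inr hq0), ENNReal.inv_div (Or.inr hq') (Or.inr hq0),
      ENNReal.div_eq_inv_mul, ENNReal.div_eq_inv_mul, ← mul_add_one, show (2 : ℝ≥0∞) + 1 = 3 by norm_num]
  have hωm := aestronglyMeasurable_uncurry_quadIncrement (T := T) (v := v) hK.continuous hvm
  have hFm : AEStronglyMeasurable (uncurry fun t x => (‖v t x‖ ^ 2 + ((fun y => ‖v t y‖ ^ 2) ⋆ K) x -
      2 * ⟪v t x, vecConv (v t) K x⟫) * ‖v t x‖) ((volume.restrict (Ioo 0 T)).prod volume) :=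
    hωm.mul hvm.norm
  set b : ℝ → ℝ≥0∞ := fun t => eBesovSupNorm θ q (v t) volume with hb
  have hslice : ∀ᵐ t ∂(volume.restrict (Ioo 0 T)),
      eLpNorm (fun x => (‖v t x‖ ^ 2 + ((fun y => ‖v t y‖ ^ 2) ⋆ K) x - 2 * ⟪v t x, vecConv (v t) K x⟫) *
        ‖v t x‖) (q / 3) volume ≤ ENNReal.ofReal (ε ^ θ) ^ 2 * b t ^ (3 : ℝ) := by
    filter_upwards [ae_aestronglyMeasurable_slice hωm, ae_aestronglyMeasurable_slice hvm, hv.1] with t hωt hvt hBt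
    have h2 : MemLp (v t) 2 volume := hBt.memLp.mono_exponent (le_trans (by norm_num) hq)
    set ω : UnitAddTorus d → ℝ := fun x => ‖v t x‖ ^ 2 + ((fun y => ‖v t y‖ ^ 2) ⋆ K) x -
      2 * ⟪v t x, vecConv (v t) K x⟫ with hω
    have e : (fun x => ω x * ‖v t x‖) = ω • fun x => ‖v t x‖ := rfl
    have hH : eLpNorm (fun x => ω x * ‖v t x‖) (q / 3) volume ≤
        eLpNorm ω (q / 2) volume * eLpNorm (fun x => ‖v t x‖) q volume := by
      rw [e]
      exact eLpNorm_smul_le_mul_eLpNorm hvt.norm hωt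
    refine hH.trans ?_
    rw [eLpNorm_norm]
    calc eLpNorm ω (q / 2) volume * eLpNorm (v t) q volume
        ≤ (eBesovSupSeminorm θ (2 * (q / 2)) (v t) volume * ENNReal.ofReal (ε ^ θ)) ^ 2 * b t := by
          gcongr
          · exact eLpNorm_quadIncrement_le h2 hε hε' hq2 hq2t hθ
          · exact (eLpNorm_le_eBesovSupNorm' (v t) θ q).1
      _ ≤ (b t * ENNReal.ofReal (ε ^ θ)) ^ 2 * b t := by
          rw [two_mul_div_two]
          gcongr
          exact (eLpNorm_le_eBesovSupNorm' (v t) θ q).2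
      _ = ENNReal.ofReal (ε ^ θ) ^ 2 * b t ^ (3 : ℝ) := by
          rw [show (3 : ℝ) = ((3 : ℕ) : ℝ) by norm_num, ENNReal.rpow_natCast]
          ring
  have hc : ENNReal.ofReal (ε ^ θ) ^ 2 ≠ ⊤ := ENNReal.pow_ne_top ENNReal.ofReal_ne_top
  refine (eLpNorm_uncurry_le_of_slice_le hFm hr0 hrt hc hslice).trans (le_of_eq ?_)
  congr 1
  have e1 : ∀ t, (b t ^ (3 : ℝ)) ^ (q / 3).toReal = b t ^ q.toReal := fun t => by
    rw [← ENNReal.rpow_mul, hr3]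
    congr 1
    ring
  simp_rw [e1]
  rw [lintegral_eBesovSupNorm_rpow_eq hq0 hq' hv, rpow_toReal_rpow_inv_div_three hq hq']

/-- The pressure commutator field `𝒞_K(p,v) = (pv) ⋆ K + pv - p(v ⋆ K) - (p ⋆ K)v` is jointly
measurable. [folklore] -/
theorem aestronglyMeasurable_uncurry_pressureRemainder {K : UnitAddTorus d → ℝ} (hKc : Continuous K)
    (hvm : AEStronglyMeasurable (uncurry v) ((volume.restrict (Ioo 0 T)).prod volume))
    (hpm : AEStronglyMeasurable (uncurry p) ((volume.restrict (Ioo 0 T)).prod volume)) :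
    AEStronglyMeasurable (uncurry fun t x => vecConv (fun y => p t y • v t y) K x + p t x • v t x -
      p t x • vecConv (v t) K x - (p t ⋆ K) x • v t x) ((volume.restrict (Ioo 0 T)).prod volume) := by
  have hpv : AEStronglyMeasurable (uncurry fun t y => p t y • v t y) ((volume.restrict (Ioo 0 T)).prod volume) :=
    hpm.smul hvm
  have h1 := aestronglyMeasurable_uncurry_vecConv hpv hKc
  have h2 := aestronglyMeasurable_uncurry_vecConv hvm hKc
  have h3 := FunctionSpaces.Torus.aestronglyMeasurable_uncurry_convolution (ContinuousLinearMap.lsmul ℝ ℝ) hpm hKc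
  exact ((h1.add hpv).sub (hpm.smul h2)).sub (h3.smul hvm)

/-- **The pressure commutator term** (De Rosa–Isett 2024, (est_II)/(est_III)): given the
slice-wise Besov bound `[p(t)]_{B^θ_{q/2}} ≤ C_q ‖v(t)‖_q [v(t)]_{B^θ_q}` (a.e. `t`) and slice
integrability of `p`, `pv`, `‖𝒞_{k_ε}(p,v)‖_{L^{q/3}((0,T) × T^d)} ≤ C_q ε^{2θ} N³`. [cite: DeRosaIsett2024, §5.1 (est_II)] -/
theorem eLpNorm_uncurry_pressureRemainder_le
    (hvm : AEStronglyMeasurable (uncurry v) ((volume.restrict (Ioo 0 T)).prod volume))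
    (hpm : AEStronglyMeasurable (uncurry p) ((volume.restrict (Ioo 0 T)).prod volume))
    (hq : 3 ≤ q) (hq' : q ≠ ⊤) (hθ : 0 < θ) (hv : MemLpBesovSup q θ q v volume (Ioo 0 T))
    (hpi : ∀ᵐ t ∂(volume.restrict (Ioo 0 T)),
      Integrable (p t) volume ∧ Integrable (fun y => p t y • v t y) volume)
    {Cq : ℝ≥0∞} (hCq : Cq ≠ ⊤)
    (hP : ∀ᵐ t ∂(volume.restrict (Ioo 0 T)), eBesovSupSeminorm θ (q / 2) (p t) volume ≤
      Cq * eLpNorm (v t) q volume * eBesovSupSeminorm θ q (v t) volume)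
    (hε : 0 < ε) (hε' : ε ≤ 1 / 4) :
    eLpNorm (uncurry fun t x => vecConv (fun y => p t y • v t y) (FunctionSpaces.Torus.kernel ε) x +
        p t x • v t x - p t x • vecConv (v t) (FunctionSpaces.Torus.kernel ε) x -
        (p t ⋆ FunctionSpaces.Torus.kernel ε) x • v t x) (q / 3)
        ((volume.restrict (Ioo 0 T)).prod volume) ≤
      Cq * ENNReal.ofReal (ε ^ θ) ^ 2 * eLpBesovSupNorm q θ q v volume (Ioo 0 T) ^ (3 : ℕ) := by
  set K := FunctionSpaces.Torus.kernel (d := d) ε with hKdef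
  have hK : FunctionSpaces.Torus.IsSmooth K := FunctionSpaces.Torus.isSmooth_kernel hε hε'
  obtain ⟨hr1, hr0, hrt, hr3⟩ := div_three_facts hq hq'
  have hq0 : q ≠ 0 := (lt_of_lt_of_le (by norm_num) hq).ne'
  haveI hHT : ENNReal.HolderTriple (q / 2) q (q / 3) := by
    refine ⟨?_⟩
    rw [ENNReal.inv_div (Or.inr hq') (Or.inr hq0), ENNReal.inv_div (Or.inr hq') (Or.inr hq0),
      ENNReal.div_eq_inv_mul, ENNReal.div_eq_inv_mul, ← mul_add_one, show (2 : ℝ≥0∞) + 1 = 3 by norm_num]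
  have hFm := aestronglyMeasurable_uncurry_pressureRemainder (T := T) (v := v) (p := p) hK.continuous hvm hpm
  set b : ℝ → ℝ≥0∞ := fun t => eBesovSupNorm θ q (v t) volume with hb
  have hslice : ∀ᵐ t ∂(volume.restrict (Ioo 0 T)),
      eLpNorm (fun x => vecConv (fun y => p t y • v t y) K x + p t x • v t x - p t x • vecConv (v t) K x -
        (p t ⋆ K) x • v t x) (q / 3) volume ≤ (Cq * ENNReal.ofReal (ε ^ θ) ^ 2) * b t ^ (3 : ℝ) := by
    filter_upwards [hpi, hP, hv.1] with t hpt hPt hBt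
    have hvi : Integrable (v t) volume := hBt.memLp.integrable (le_trans (by norm_num) hq)
    calc eLpNorm (fun x => vecConv (fun y => p t y • v t y) K x + p t x • v t x - p t x • vecConv (v t) K x -
          (p t ⋆ K) x • v t x) (q / 3) volume
        ≤ eBesovSupSeminorm θ (q / 2) (p t) volume * eBesovSupSeminorm θ q (v t) volume *
            ENNReal.ofReal (ε ^ θ) ^ 2 := eLpNorm_pressureRemainder_le hpt.1 hvi hpt.2 hε hε' hr1 hrt hθ
      _ ≤ (Cq * eLpNorm (v t) q volume * eBesovSupSeminorm θ q (v t) volume) *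
            eBesovSupSeminorm θ q (v t) volume * ENNReal.ofReal (ε ^ θ) ^ 2 := by gcongr
      _ ≤ (Cq * b t * b t) * b t * ENNReal.ofReal (ε ^ θ) ^ 2 := by
          gcongr
          · exact (eLpNorm_le_eBesovSupNorm' (v t) θ q).1
          · exact (eLpNorm_le_eBesovSupNorm' (v t) θ q).2
          · exact (eLpNorm_le_eBesovSupNorm' (v t) θ q).2
      _ = (Cq * ENNReal.ofReal (ε ^ θ) ^ 2) * b t ^ (3 : ℝ) := by
          rw [show (3 : ℝ) = ((3 : ℕ) : ℝ) by norm_num, ENNReal.rpow_natCast]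
          ring
  have hc : Cq * ENNReal.ofReal (ε ^ θ) ^ 2 ≠ ⊤ :=
    ENNReal.mul_ne_top hCq (ENNReal.pow_ne_top ENNReal.ofReal_ne_top)
  refine (eLpNorm_uncurry_le_of_slice_le hFm hr0 hrt hc hslice).trans (le_of_eq ?_)
  congr 1
  have e1 : ∀ t, (b t ^ (3 : ℝ)) ^ (q / 3).toReal = b t ^ q.toReal := fun t => by
    rw [← ENNReal.rpow_mul, hr3]
    congr 1
    ring
  simp_rw [e1]
  rw [lintegral_eBesovSupNorm_rpow_eq hq0 hq' hv, rpow_toReal_rpow_inv_div_three hq hq']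

end Terms

end Literature.Analysis.FluidPDE.Torus

end
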